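import Literature.NumberTheory.Automorphic.AdelicHeightZetaConvergence
import HarnessLib

/-!
# The height zeta function `g ↦ Σ_{ξ ∈ ℙ^{n−1}(K)} h(ξ g)^{−τ}` is bounded on compact subsets of `GL_n(𝔸_K)`

Topic `NumberTheory/Automorphic`; namespace `Literature.NumberTheory.Automorphic` (sequel of `AdelicHeightZetaConvergence`,
`AdelicVectorHeightBound`).  KERNEL only: proved theorems, no definition, no named fact.

* §1 `exists_finset_forall_mem_adicCompletionIntegers_of_isCompact` — **a compact set of finite adeles is integral outside a finite
  set of places** (the restricted-product topology: the open sets `{x : x_v ∈ 𝒪_v ∀ v ∉ S}`, `S` finite, cover and are directed);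
* §2 `exists_matHeightBound_le_of_isCompact` — Godement's matrix height `H(M) = ∏_w ‖M‖_{w,Frob}^{mult w} · ∏_v max(1, maxᵢⱼ |Mᵢⱼ|_v)`
  (`matHeightBound` of ★ `AdelicVectorHeightBound`) is **bounded on compact sets of adelic matrices** (archimedean entries by
  continuity; finitely many bad finite places by §1, each bounded by continuity) — the compact form of Godement, Sém. Bourbaki 257,
  §1.1 (vi) «si `M` est une partie compacte de `GL(V_A)` il existe des constantes `c′‖x‖ ≤ ‖m(x)‖ ≤ c″‖x‖`» = [Garrett2018, Thm. 2.2.2: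
  `h(x) ≪_C h(x g) ≪_C h(x)` for `g` in a compact `C`];
* §3 `vecHeight_ratVec_vecMul_le_matHeightBound_mul` (`h(ξ g′) ≤ H(g⁻¹ g′) h(ξ g)`), `vecHeight_rpow_neg_le_matHeightBound_rpow_mul`, and
  **`exists_tsum_vecHeight_rpow_neg_le_of_isCompact`: for compact `C ⊆ GL_n(𝔸_K)` and `τ > n` there is `B` with
  `Σ_{[ξ] ∈ ℙ^{n−1}(K)} h(ξ g)^{−τ} ≤ B` for all `g ∈ C`** (★ `summable_vecHeight_rpow_neg` + §2) — the «bounded on compacta» form of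
  the convergence of the minimal-parabolic Eisenstein majorant [Garrett2018, §3.3; JacquetShalikaAJM1981, §4] that the uniform Siegel–Weil
  convergence (E-2 lead ruling: uniformity on compacta of the group) consumes.

Written for the Hodge-CM cell `pub/hodgecm-mathlib`, floor 0, line `F0_P4AdmissibleOccursInH1` ∕ E-2 grandchild piece SW2a (3) CONV, seat
F0P4-p08, 2026-08-31.

## References

* R. Godement, *Domaines fondamentaux des groupes arithmétiques*, Sém. Bourbaki 257 (1962/63), §1.1 (vi).
* [Garrett2018] P. Garrett, *Modern Analysis of Automorphic Forms by Example* (2018), Thm. 2.2.2 (PDF p. 82), §3.3.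
* [JacquetShalikaAJM1981] H. Jacquet, J. A. Shalika, Amer. J. Math. 103 (1981), §4.
-/

noncomputable section

open scoped NNReal Matrix
open NumberField IsDedekindDomain Matrix

namespace Literature.NumberTheory.Automorphic

/-! ## §1 A compact set of finite adeles is integral outside a finite set of places -/

section IntegralOutside

variable (K : Type) [Field K] [NumberField K]

/-- **a compact set of finite adeles is integral outside a finite set of places**: for compact `E ⊆ 𝔸_K^∞` there is a finite
`S` with `x_v ∈ 𝒪_v` for all `x ∈ E`, `v ∉ S` (the sets `{x : ∀ v ∉ S, x_v ∈ 𝒪_v}` are open, increasing in `S`, and cover).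
[cite: Garrett2018, Thm. 2.2.2 (PDF p. 82)] -/
theorem exists_finset_forall_mem_adicCompletionIntegers_of_isCompact {E : Set (FiniteAdeleRing (𝓞 K) K)}
    (hE : IsCompact E) :
    ∃ S : Finset (HeightOneSpectrum (𝓞 K)), ∀ x ∈ E, ∀ v : HeightOneSpectrum (𝓞 K),
      v ∉ S → x v ∈ v.adicCompletionIntegers K := by
  classical
  set O : Finset (HeightOneSpectrum (𝓞 K)) → Set (FiniteAdeleRing (𝓞 K) K) := fun S =>
    {x | ∀ v : HeightOneSpectrum (𝓞 K), v ∉ S → x v ∈ v.adicCompletionIntegers K} with hO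
  have hOo : ∀ S, IsOpen (O S) := fun S =>
    RestrictedProduct.isOpen_forall_imp_mem (fun v => Valued.isOpen_valuationSubring (v.adicCompletion K))
  have hcov : E ⊆ ⋃ S, O S := by
    intro x _
    have hx : ∀ᶠ v : HeightOneSpectrum (𝓞 K) in Filter.cofinite, x v ∈ v.adicCompletionIntegers K := x.2
    refine Set.mem_iUnion.2 ⟨(Filter.eventually_cofinite.1 hx).toFinset, fun v hv => ?_⟩
    by_contra h
    exact hv (by simpa using h)
  obtain ⟨t, ht⟩ := hE.elim_finite_subcover O hOo hcov
  refine ⟨t.biUnion id, fun x hx v hv => ?_⟩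
  obtain ⟨S, hS, hxS⟩ := Set.mem_iUnion₂.1 (ht hx)
  exact hxS v fun h => hv (Finset.mem_biUnion.2 ⟨S, hS, h⟩)

end IntegralOutside

/-! ## §2 Godement's matrix height is bounded on compact sets -/

section MatHeight

variable (K : Type) [Field K] [NumberField K] {ι κ : Type*} [Fintype ι] [Fintype κ]

omit [Fintype ι] [Fintype κ] in
/-- the `(i, j)` entry of an adelic matrix depends continuously on the matrix. [folklore] -/
private theorem continuous_entry (i : ι) (j : κ) :
    Continuous fun M : Matrix ι κ (AdeleRing (𝓞 K) K) => M i j :=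
  (continuous_apply j).comp (continuous_apply i)

/-- **Godement's matrix height is bounded on compact sets of adelic matrices** (compact form of Sém. Bourbaki 257 §1.1 (vi);
Garrett's `h(x g) ≪_C h(x)` for `g` in a compact `C`).  The same statement exists in the cell package module
`Summits/HodgeConjecture/HodgeCM/PerL34/GodementHyperbolic_1.lean` as `HodgeCM.PerL34.Godement.exists_matHeightBound_le_of_isCompact`
(not importable from `Literature/`); this is its Literature-side home, proved independently. [cite: Garrett2018, Thm. 2.2.2 (PDF p. 82)] -/
theorem exists_matHeightBound_le_of_isCompact {C : Set (Matrix ι κ (AdeleRing (𝓞 K) K))} (hC : IsCompact C) :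
    ∃ B : ℝ≥0, ∀ M ∈ C, matHeightBound K M ≤ B := by
  classical
  -- archimedean entries are bounded
  have harch : ∀ (ij : ι × κ) (w : InfinitePlace K), ∃ c : ℝ, ∀ M ∈ C, ‖(M ij.1 ij.2).1 w‖ ≤ c :=
    fun ij w => hC.exists_bound_of_continuousOn
      (((continuous_apply w).comp (continuous_fst.comp (continuous_entry K ij.1 ij.2))).continuousOn)
  choose ca hca using harch
  -- finite entries are bounded
  have hfin : ∀ (ij : ι × κ) (v : HeightOneSpectrum (𝓞 K)), ∃ c : ℝ, ∀ M ∈ C, ‖(M ij.1 ij.2).2 v‖ ≤ c :=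
    fun ij v => hC.exists_bound_of_continuousOn
      (((RestrictedProduct.continuous_eval v).comp (continuous_snd.comp (continuous_entry K ij.1 ij.2))).continuousOn)
  choose cf hcf using hfin
  -- and integral outside a finite set `S`
  have hE : IsCompact (⋃ ij : ι × κ, (fun M : Matrix ι κ (AdeleRing (𝓞 K) K) => (M ij.1 ij.2).2) '' C) :=
    isCompact_iUnion fun ij => hC.image (continuous_snd.comp (continuous_entry K ij.1 ij.2))
  obtain ⟨S, hS⟩ := exists_finset_forall_mem_adicCompletionIntegers_of_isCompact K hE
  have hint : ∀ M ∈ C, ∀ v : HeightOneSpectrum (𝓞 K), v ∉ S → ∀ ij : ι × κ,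
      (M ij.1 ij.2).2 v ∈ v.adicCompletionIntegers K :=
    fun M hM v hv ij => hS _ (Set.mem_iUnion.2 ⟨ij, M, hM, rfl⟩) v hv
  -- the bounds
  set A : InfinitePlace K → ℝ≥0 := fun w => NNReal.sqrt (∑ ij : ι × κ, (ca ij w).toNNReal ^ 2) with hA
  set Bf : HeightOneSpectrum (𝓞 K) → ℝ≥0 := fun v => Finset.univ.sup fun ij : ι × κ => (cf ij v).toNNReal with hBf
  refine ⟨(∏ w : InfinitePlace K, A w ^ w.mult) * ∏ v ∈ S, (1 ⊔ Bf v), fun M hM => ?_⟩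
  rw [matHeightBound]
  refine mul_le_mul' ?_ ?_
  · refine Finset.prod_le_prod' fun w _ => pow_le_pow_left' ?_ _
    rw [matArchBound, hA]
    refine NNReal.sqrt_le_sqrt.2 (Finset.sum_le_sum fun ij _ => pow_le_pow_left' ?_ 2)
    rw [← NNReal.coe_le_coe, coe_nnnorm, Real.coe_toNNReal _ ((norm_nonneg _).trans (hca ij w M hM))]
    exact hca ij w M hM
  · have hsupp : (Function.mulSupport fun v => 1 ⊔ matFinBound K v M) ⊆ (S : Set (HeightOneSpectrum (𝓞 K))) := by
      intro v hv
      by_contra hvS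
      refine hv ?_
      refine sup_eq_left.2 (Finset.sup_le fun ij _ => ?_)
      rw [← NNReal.coe_le_coe, coe_nnnorm, NNReal.coe_one]
      exact Valued.toNormedField.norm_le_one_iff.2 (hint M hM v hvS ij)
    rw [finprod_eq_prod_of_mulSupport_subset _ hsupp]
    refine Finset.prod_le_prod' fun v _ => sup_le_sup_left ?_ _
    refine Finset.sup_le fun ij _ => ?_
    refine le_trans ?_ (Finset.le_sup (f := fun ij : ι × κ => (cf ij v).toNNReal) (Finset.mem_univ ij))
    rw [← NNReal.coe_le_coe, coe_nnnorm, Real.coe_toNNReal _ ((norm_nonneg _).trans (hcf ij v M hM))]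
    exact hcf ij v M hM

end MatHeight

/-! ## §3 Uniform bound for the height zeta function on compact sets -/

section Uniform

variable (K : Type) [Field K] [NumberField K] {m : ℕ}

/-- **`h(ξ g′) ≤ H(g⁻¹ g′) · h(ξ g)`** for a non-zero rational `ξ` and `g, g′ ∈ GL_n(𝔸_K)` (`ξ g′ = (ξ g)(g⁻¹ g′)` and
★ `vecHeight_vecMul_le`). [cite: Garrett2018, Thm. 2.2.2 (PDF p. 82)] -/
theorem vecHeight_ratVec_vecMul_le_matHeightBound_mul {ξ : Fin (m + 1) → K} (hξ : ξ ≠ 0)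
    (g g' : GL (Fin (m + 1)) (AdeleRing (𝓞 K) K)) :
    vecHeight K (ratVec K ξ ᵥ* (g' : Matrix (Fin (m + 1)) (Fin (m + 1)) (AdeleRing (𝓞 K) K))) ≤
      matHeightBound K ((g⁻¹ * g' : GL (Fin (m + 1)) (AdeleRing (𝓞 K) K)) :
        Matrix (Fin (m + 1)) (Fin (m + 1)) (AdeleRing (𝓞 K) K)) *
      vecHeight K (ratVec K ξ ᵥ* (g : Matrix (Fin (m + 1)) (Fin (m + 1)) (AdeleRing (𝓞 K) K))) := by
  classical
  have h1 : ratVec K ξ ᵥ* (g' : Matrix (Fin (m + 1)) (Fin (m + 1)) (AdeleRing (𝓞 K) K)) =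
      (ratVec K ξ ᵥ* (g : Matrix (Fin (m + 1)) (Fin (m + 1)) (AdeleRing (𝓞 K) K))) ᵥ*
        ((g⁻¹ * g' : GL (Fin (m + 1)) (AdeleRing (𝓞 K) K)) : Matrix (Fin (m + 1)) (Fin (m + 1)) (AdeleRing (𝓞 K) K)) := by
    rw [Matrix.vecMul_vecMul, ← Units.val_mul, mul_inv_cancel_left]
  have hg : IsHeightFinite K (ratVec K ξ ᵥ* (g : Matrix (Fin (m + 1)) (Fin (m + 1)) (AdeleRing (𝓞 K) K))) :=
    isHeightFinite_principalVec_vecMul hξ g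
  have hg' : IsHeightFinite K (ratVec K ξ ᵥ* (g' : Matrix (Fin (m + 1)) (Fin (m + 1)) (AdeleRing (𝓞 K) K))) :=
    isHeightFinite_principalVec_vecMul hξ g'
  rw [h1] at hg' ⊢
  exact vecHeight_vecMul_le hg hg'

/-- **`h(ξ g′)^{−τ} ≤ H(g′⁻¹ g)^τ · h(ξ g)^{−τ}`** (`τ ≥ 0`): inverse powers of heights of primitive vectors compare through Godement's
matrix height. [cite: Garrett2018, Thm. 2.2.2 (PDF p. 82)] -/
theorem vecHeight_rpow_neg_le_matHeightBound_rpow_mul {ξ : Fin (m + 1) → K} (hξ : ξ ≠ 0)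
    (g g' : GL (Fin (m + 1)) (AdeleRing (𝓞 K) K)) {τ : ℝ} (hτ : 0 ≤ τ) :
    ((vecHeight K (ratVec K ξ ᵥ* (g' : Matrix (Fin (m + 1)) (Fin (m + 1)) (AdeleRing (𝓞 K) K))) : ℝ≥0) : ℝ) ^ (-τ) ≤
      ((matHeightBound K ((g'⁻¹ * g : GL (Fin (m + 1)) (AdeleRing (𝓞 K) K)) :
          Matrix (Fin (m + 1)) (Fin (m + 1)) (AdeleRing (𝓞 K) K)) : ℝ≥0) : ℝ) ^ τ *
        ((vecHeight K (ratVec K ξ ᵥ* (g : Matrix (Fin (m + 1)) (Fin (m + 1)) (AdeleRing (𝓞 K) K))) : ℝ≥0) : ℝ) ^ (-τ) := by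
  set a : ℝ := ((vecHeight K (ratVec K ξ ᵥ* (g' : Matrix (Fin (m + 1)) (Fin (m + 1)) (AdeleRing (𝓞 K) K))) : ℝ≥0) : ℝ)
    with ha
  set b : ℝ := ((vecHeight K (ratVec K ξ ᵥ* (g : Matrix (Fin (m + 1)) (Fin (m + 1)) (AdeleRing (𝓞 K) K))) : ℝ≥0) : ℝ)
    with hb
  set H : ℝ := ((matHeightBound K ((g'⁻¹ * g : GL (Fin (m + 1)) (AdeleRing (𝓞 K) K)) :
    Matrix (Fin (m + 1)) (Fin (m + 1)) (AdeleRing (𝓞 K) K)) : ℝ≥0) : ℝ) with hH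
  have ha0 : 0 < a := NNReal.coe_pos.2 (vecHeight_ratVec_vecMul_pos K hξ g')
  have hb0 : 0 < b := NNReal.coe_pos.2 (vecHeight_ratVec_vecMul_pos K hξ g)
  have hH0 : 0 ≤ H := NNReal.coe_nonneg _
  -- `b ≤ H a`
  have hle : b ≤ H * a := by
    have h := vecHeight_ratVec_vecMul_le_matHeightBound_mul K hξ g' g
    rw [← NNReal.coe_le_coe, NNReal.coe_mul] at h
    exact h
  have hinv : a⁻¹ ≤ H * b⁻¹ := by
    rw [inv_le_iff_one_le_mul₀ ha0, mul_assoc, mul_comm b⁻¹ a, ← mul_assoc, ← div_eq_mul_inv, one_le_div hb0]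
    exact hle
  rw [Real.rpow_neg ha0.le, Real.rpow_neg hb0.le, ← Real.inv_rpow ha0.le, ← Real.inv_rpow hb0.le,
    ← Real.mul_rpow hH0 (inv_nonneg.2 hb0.le)]
  exact Real.rpow_le_rpow (inv_nonneg.2 ha0.le) hinv hτ

/-- **THE HEIGHT ZETA FUNCTION IS BOUNDED ON COMPACT SETS**: for compact `C ⊆ GL_n(𝔸_K)` (`n = m + 1`) and `τ > n` there is
`B` with `Σ_{[ξ] ∈ ℙ^{n−1}(K)} h(ξ g)^{−τ} ≤ B` for every `g ∈ C` — the minimal-parabolic Eisenstein majorant is bounded on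
compacta (`Σ h(ξ g)^{−τ} ≤ H(g⁻¹)^τ Σ h(ξ)^{−τ}` and §2). [cite: Garrett2018, Thm. 2.2.2 (PDF p. 82) and §3.3; JacquetShalikaAJM1981, §4] -/
theorem exists_tsum_vecHeight_rpow_neg_le_of_isCompact {C : Set (GL (Fin (m + 1)) (AdeleRing (𝓞 K) K))}
    (hC : IsCompact C) {τ : ℝ} (hτ : (m + 1 : ℝ) < τ) :
    ∃ B : ℝ, ∀ g ∈ C,
      ∑' p : Projectivization K (Fin (m + 1) → K),
        ((vecHeight K (ratVec K p.rep ᵥ* (g : Matrix (Fin (m + 1)) (Fin (m + 1)) (AdeleRing (𝓞 K) K))) : ℝ≥0) : ℝ) ^ (-τ)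
        ≤ B := by
  have hτ0 : 0 ≤ τ := le_trans (by positivity) hτ.le
  -- Godement's height is bounded on the compact set `{g⁻¹ : g ∈ C}` (as matrices)
  have hC' : IsCompact ((fun g : GL (Fin (m + 1)) (AdeleRing (𝓞 K) K) =>
      ((g⁻¹ : GL (Fin (m + 1)) (AdeleRing (𝓞 K) K)) : Matrix (Fin (m + 1)) (Fin (m + 1)) (AdeleRing (𝓞 K) K))) '' C) :=
    hC.image (Units.continuous_val.comp continuous_inv)
  obtain ⟨BH, hBH⟩ := exists_matHeightBound_le_of_isCompact K hC'
  -- the sum at `g = 1`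
  set Z : ℝ := ∑' p : Projectivization K (Fin (m + 1) → K),
    ((vecHeight K (ratVec K p.rep ᵥ* ((1 : GL (Fin (m + 1)) (AdeleRing (𝓞 K) K)) :
      Matrix (Fin (m + 1)) (Fin (m + 1)) (AdeleRing (𝓞 K) K))) : ℝ≥0) : ℝ) ^ (-τ) with hZ
  have hZs := summable_vecHeight_rpow_neg K (1 : GL (Fin (m + 1)) (AdeleRing (𝓞 K) K)) hτ
  refine ⟨((BH : ℝ≥0) : ℝ) ^ τ * Z, fun g hg => ?_⟩
  have hHg : ((matHeightBound K ((g⁻¹ * 1 : GL (Fin (m + 1)) (AdeleRing (𝓞 K) K)) :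
      Matrix (Fin (m + 1)) (Fin (m + 1)) (AdeleRing (𝓞 K) K)) : ℝ≥0) : ℝ) ≤ BH := by
    rw [mul_one]
    exact_mod_cast hBH _ ⟨g, hg, rfl⟩
  have hterm : ∀ p : Projectivization K (Fin (m + 1) → K),
      ((vecHeight K (ratVec K p.rep ᵥ* (g : Matrix (Fin (m + 1)) (Fin (m + 1)) (AdeleRing (𝓞 K) K))) : ℝ≥0) : ℝ) ^ (-τ) ≤
        ((BH : ℝ≥0) : ℝ) ^ τ *
          ((vecHeight K (ratVec K p.rep ᵥ* ((1 : GL (Fin (m + 1)) (AdeleRing (𝓞 K) K)) :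
            Matrix (Fin (m + 1)) (Fin (m + 1)) (AdeleRing (𝓞 K) K))) : ℝ≥0) : ℝ) ^ (-τ) := by
    intro p
    refine le_trans (vecHeight_rpow_neg_le_matHeightBound_rpow_mul K p.rep_nonzero 1 g hτ0) ?_
    refine mul_le_mul_of_nonneg_right (Real.rpow_le_rpow (NNReal.coe_nonneg _) hHg hτ0) ?_
    exact Real.rpow_nonneg (NNReal.coe_nonneg _) _
  calc ∑' p : Projectivization K (Fin (m + 1) → K),
        ((vecHeight K (ratVec K p.rep ᵥ* (g : Matrix (Fin (m + 1)) (Fin (m + 1)) (AdeleRing (𝓞 K) K))) : ℝ≥0) : ℝ) ^ (-τ)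
      ≤ ∑' p : Projectivization K (Fin (m + 1) → K), ((BH : ℝ≥0) : ℝ) ^ τ *
          ((vecHeight K (ratVec K p.rep ᵥ* ((1 : GL (Fin (m + 1)) (AdeleRing (𝓞 K) K)) :
            Matrix (Fin (m + 1)) (Fin (m + 1)) (AdeleRing (𝓞 K) K))) : ℝ≥0) : ℝ) ^ (-τ) :=
        Summable.tsum_le_tsum hterm (summable_vecHeight_rpow_neg K g hτ) (hZs.mul_left _)
    _ = ((BH : ℝ≥0) : ℝ) ^ τ * Z := by rw [tsum_mul_left]

end Uniform

end Literature.NumberTheory.Automorphic
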